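import Literature.AlgebraicGeometry.ModuliOfAbelianVarieties.SiegelFamilyShimuraLocusIdentityTheorem
import Mathlib.LinearAlgebra.Complex.FiniteDimensional
import Mathlib.Data.Sym.Card
import HarnessLib

/-!
# The locus `𝔜_j` is a real form of `Sym_g(ℂ)`: its directions form a real subspace of dimension
# `g(g+1)/2 = dim_ℂ 𝔖_g` (Shimura 1972, §3 Prop. 11: the real coordinates `x, y, r, s` of `𝔜`)

Topic `Literature/AlgebraicGeometry/ModuliOfAbelianVarieties` (the Siegel-family files, namespace
`Literature.AlgebraicGeometry.ModuliOfAbelianVarieties.SiegelModuli`).  Lane `lit-hodgefound`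
(Track 2 foundations library), prover seat p15 generation 49, row g49-#8, complementing g49-#3
(`SiegelFamilyShimuraLocusIdentityTheorem`: `𝔜_j` is the fixed locus of the conjugate-linear involution
`c_j(Z) = jZ̄j` of `Sym_g(ℂ)`, and holomorphic functions vanishing on an open piece of it vanish) and g49-#6
(`𝔥_g ∩ 𝔜_j` is the image of the sweep).  Prop. 11's proof lists the REAL coordinates of `𝔜`
(`ᵗx = x, ᵗy = y, ᵗr = r, ᵗs = −s` for `n = 2m`: `3·m(m+1)/2 + m(m−1)/2 = n(n+1)/2` of them); THIS FILE proves
the coordinate-free statement behind «a non-empty open subset of `D ∩ 𝔜`»: the fixed space of a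
conjugate-linear involution of a finite-dimensional complex space has real dimension equal to the complex
dimension (a REAL FORM), hence the directions of `𝔜_j` in Klingen's coordinates of `Sym_g(ℂ)` form a real
subspace of dimension `g(g+1)/2`.  THEOREMS ONLY: no definition, no instance, no notation, no named fact
(net Literature debt `0`), no `sorry`.

## Source, VERBATIM

G. Shimura, *On the field of rationality for an abelian variety*, Nagoya Math. J. **45** (1972) 167–178,
held `paper:doi-10-1017-s0027763000014720`, §3 Prop. 11 and its proof, pp. 175–176: «The set `𝔜` of
Prop. 10 is non-empty.  Moreover, let `g` be a holomorphic function defined on a connected domain `D`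
contained in `𝔖_n`.  If `g = 0` on a non-empty open subset of `D ∩ 𝔜`, then `g` is identically `0` on
`D`.  Proof. … every point `z` of `𝔜` can be written in the form `z = (a b; b′ −a^ρ)` with complex
matrices `a` and `b` of size `m` such that `ᵗa = a`, `ᵗb^ρ = b`. … If we put `a = x + iy` and `b = r + is`
with real matrices `x, y, r, s`, then the conditions become as follows: `ᵗx = x, ᵗy = y, ᵗr = r, ᵗs = −s`;
`(y s; −s y)` is positive definite.»  (Klingen 1990, Ch. I §1 Def. 2: the coordinates `z_{kl}`, `k ≤ l`, of
`Sym_n(ℂ)`, the tree's `coordCLE`.)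

## The tree's rendering

* **§1 Real forms have half the real dimension** (`finrank_ker_sub_id_of_conjLinear_involution`): for an
  `ℝ`-linear `c : E → E` on a finite-dimensional complex `E` with `c(iv) = −i c(v)` and `c² = id`, the fixed
  space `V = ker(c − 1)` satisfies `dim_ℝ V = dim_ℂ E`: `E = V ⊕ W`, `W = ker(c + 1)`, and `v ↦ iv` maps
  `V` into `W` and `W` into `V` injectively.
* **§2 The directions of `𝔜_j`** (`exists_submodule_locus_finrank`): for an integral `j` with `j² = −1`,
  `ᵗj = −j`, the coordinate vectors `v ∈ ℂ^{g(g+1)/2}` whose symmetric matrix `Z_v` satisfies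
  `jZ_v = −Z̄_v j` form an `ℝ`-subspace of dimension `#Sym2(Fin g) = g(g+1)/2` — the fixed space of
  `c_j = coordCLE ∘ (Z ↦ jZ̄j) ∘ coordCLE⁻¹` (g49-#3) — and `𝔥_g ∩ 𝔜_j` is its intersection with the open
  cone `Im Z ≻ 0` (g49-#6/#7); `card_sym2_fin` records `#Sym2(Fin g) = g(g+1)/2`.
-/

noncomputable section

open scoped Matrix ComplexConjugate
open Matrix Complex Function Module

namespace Literature.AlgebraicGeometry.ModuliOfAbelianVarieties

namespace SiegelModuli

open Literature.NumberTheory.ModularForms.SiegelUpperHalfSpace (coordCLE coordCLE_apply_mk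
  coe_coordCLE_symm_apply)
open Literature.LinearAlgebra.Matrix (symmetricSubmodule mem_symmetricSubmodule isSymm_coe)

/-! ## §1 The fixed space of a conjugate-linear involution is a real form: `dim_ℝ V = dim_ℂ E` -/

section RealFormDim

variable {E : Type*} [AddCommGroup E] [Module ℂ E] [FiniteDimensional ℂ E]

/-- **Real forms have half the real dimension.**  Let `c : E → E` be `ℝ`-linear on a finite-dimensional
complex vector space with `c(iv) = −i c(v)` (conjugate-linearity) and `c(c v) = v`.  Then the fixed space
`V = ker(c − 1)` has `dim_ℝ V = dim_ℂ E`: with `W = ker(c + 1)` one has `V ∩ W = 0`, `V + W = E`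
(`v = (v + cv)/2 + (v − cv)/2`), and multiplication by `i` maps `V ↪ W`, `W ↪ V`, so
`2 dim_ℝ V = dim_ℝ E = 2 dim_ℂ E` (the count of Prop. 11's real coordinates `x, y, r, s`).
[cite: Shimura1972FieldOfRationality, §3 Prop. 11 proof (the real coordinates `ᵗx = x, ᵗy = y, ᵗr = r, ᵗs = −s` of `𝔜`), pp. 175–176] -/
theorem finrank_ker_sub_id_of_conjLinear_involution (c : E →ₗ[ℝ] E)
    (hI : ∀ v, c (Complex.I • v) = -(Complex.I • c v)) (hcc : ∀ v, c (c v) = v) :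
    finrank ℝ (LinearMap.ker (c - LinearMap.id)) = finrank ℂ E := by
  set V : Submodule ℝ E := LinearMap.ker (c - LinearMap.id) with hVdef
  set W : Submodule ℝ E := LinearMap.ker (c + LinearMap.id) with hWdef
  have hV : ∀ v, v ∈ V ↔ c v = v := fun v ↦ by
    rw [hVdef, LinearMap.mem_ker, LinearMap.sub_apply, LinearMap.id_apply, sub_eq_zero]
  have hW : ∀ v, v ∈ W ↔ c v = -v := fun v ↦ by
    rw [hWdef, LinearMap.mem_ker, LinearMap.add_apply, LinearMap.id_apply, add_eq_zero_iff_eq_neg]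
  -- `V ∩ W = 0`
  have hinf : V ⊓ W = ⊥ := by
    rw [eq_bot_iff]
    intro v hv
    rw [Submodule.mem_inf] at hv
    have h1 := (hV v).1 hv.1
    have h2 := (hW v).1 hv.2
    rw [h1] at h2
    rw [Submodule.mem_bot]
    have h3 : (2 : ℂ) • v = 0 := by
      rw [two_smul]
      nth_rewrite 2 [h2]
      exact add_neg_cancel v
    exact (smul_eq_zero.1 h3).resolve_left two_ne_zero
  -- `V + W = E`
  have hsup : V ⊔ W = ⊤ := by
    rw [eq_top_iff]
    intro v _
    have hv1 : (2⁻¹ : ℝ) • (v + c v) ∈ V := (hV _).2 (by rw [map_smul, map_add, hcc, add_comm])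
    have hv2 : (2⁻¹ : ℝ) • (v - c v) ∈ W := (hW _).2 (by rw [map_smul, map_sub, hcc, ← smul_neg, neg_sub])
    have hv : v = (2⁻¹ : ℝ) • (v + c v) + (2⁻¹ : ℝ) • (v - c v) := by
      rw [← smul_add, add_add_sub_cancel, ← two_smul ℝ v, smul_smul]
      norm_num
    rw [hv]
    exact Submodule.add_mem_sup hv1 hv2
  -- multiplication by `i`
  set f : E →ₗ[ℝ] E :=
    { toFun := fun v ↦ Complex.I • v
      map_add' := fun a b ↦ smul_add _ _ _
      map_smul' := fun r v ↦ by rw [RingHom.id_apply, smul_comm] } with hf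
  have hf_apply : ∀ v, f v = Complex.I • v := fun v ↦ rfl
  have hf_inj : Function.Injective f := fun a b h ↦ by
    rw [hf_apply, hf_apply] at h
    exact smul_right_injective E Complex.I_ne_zero h
  have hfVW : ∀ v ∈ V, f v ∈ W := fun v hv ↦ (hW _).2 (by rw [hf_apply, hI, (hV v).1 hv])
  have hfWV : ∀ w ∈ W, f w ∈ V := fun w hw ↦ (hV _).2 (by rw [hf_apply, hI, (hW w).1 hw, smul_neg, neg_neg])
  have h1 : finrank ℝ V ≤ finrank ℝ W := by
    refine LinearMap.finrank_le_finrank_of_injective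
      (f := (f.domRestrict V).codRestrict W fun v ↦ hfVW v v.2) fun a b h ↦ ?_
    have h' := congrArg Subtype.val h
    exact Subtype.ext (hf_inj h')
  have h2 : finrank ℝ W ≤ finrank ℝ V := by
    refine LinearMap.finrank_le_finrank_of_injective
      (f := (f.domRestrict W).codRestrict V fun w ↦ hfWV w w.2) fun a b h ↦ ?_
    have h' := congrArg Subtype.val h
    exact Subtype.ext (hf_inj h')
  have hVW : finrank ℝ V = finrank ℝ W := le_antisymm h1 h2
  have hsum := Submodule.finrank_sup_add_finrank_inf_eq V W
  rw [hsup, hinf, finrank_top, finrank_bot, add_zero] at hsum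
  have hE : finrank ℝ E = 2 * finrank ℂ E := finrank_real_of_complex E
  omega

end RealFormDim

/-! ## §2 The directions of `𝔜_j` form a real subspace of dimension `g(g+1)/2` -/

section Locus

variable {g : ℕ} {j : Matrix (Fin g) (Fin g) ℤ}

/-- `#Sym2(Fin g) = g(g+1)/2`: the number of Klingen coordinates `z_{kl}`, `k ≤ l` («`½n(n+1)`»).
[cite: Klingen1990, Ch. I §1 Def. 2, p. 2] -/
theorem card_sym2_fin : Fintype.card (Sym2 (Fin g)) = g * (g + 1) / 2 := by
  rw [Sym2.card, Fintype.card_fin, Nat.choose_two_right, Nat.add_sub_cancel, mul_comm]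

/-- **The directions of `𝔜_j` form a real form of `Sym_g(ℂ) ≅ ℂ^{g(g+1)/2}`.**  For an integral `j` with
`j² = −1`, `ᵗj = −j`, the coordinate vectors `v` (Klingen's `z_{kl}`, `k ≤ l`) whose symmetric matrix `Z_v`
satisfies `jZ_v = −Z̄_v j` form an `ℝ`-linear subspace `V` of `ℂ^{g(g+1)/2}` of real dimension
`#Sym2(Fin g) = g(g+1)/2 = dim_ℂ Sym_g(ℂ)` — `V` is the fixed space of the conjugate-linear involution
`c_j : Z ↦ jZ̄j` (g49-#3), and `𝔥_g ∩ 𝔜_j = V ∩ {Im Z ≻ 0}`; Prop. 11 exhibits the `n(n+1)/2` real coordinates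
`x, y, r, s`. [cite: Shimura1972FieldOfRationality, §3 Prop. 11 and its proof, pp. 175–176] [cite: Klingen1990, Ch. I §1 Def. 2, p. 2] -/
theorem exists_submodule_locus_finrank (hjj : j * j = -1) (hjT : jᵀ = -j) :
    ∃ V : Submodule ℝ (Sym2 (Fin g) → ℂ),
      (∀ v : Sym2 (Fin g) → ℂ, v ∈ V ↔
        j.map (Int.cast : ℤ → ℂ) * ((coordCLE g).symm v : Matrix (Fin g) (Fin g) ℂ) =
          -((coordCLE g).symm v : Matrix (Fin g) (Fin g) ℂ).map conj * j.map (Int.cast : ℤ → ℂ)) ∧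
      finrank ℝ V = Fintype.card (Sym2 (Fin g)) := by
  set J := j.map (Int.cast : ℤ → ℂ) with hJ
  -- the conjugation `c_j` in coordinates, as in g49-#3
  set c : (Sym2 (Fin g) → ℂ) → (Sym2 (Fin g) → ℂ) := fun v ↦
    coordCLE g ⟨J * ((coordCLE g).symm v : Matrix (Fin g) (Fin g) ℂ).map conj * J,
      mem_symmetricSubmodule.2 (isSymm_locusConj hjT (isSymm_coe _))⟩ with hc
  have hc_apply : ∀ v i k, c v s(i, k) = (J * ((coordCLE g).symm v : Matrix (Fin g) (Fin g) ℂ).map conj * J) i k :=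
    fun v i k ↦ rfl
  have hc_symm : ∀ v, ((coordCLE g).symm (c v) : Matrix (Fin g) (Fin g) ℂ) =
      J * ((coordCLE g).symm v : Matrix (Fin g) (Fin g) ℂ).map conj * J := fun v ↦ by
    rw [hc]
    dsimp only
    rw [ContinuousLinearEquiv.symm_apply_apply]
  have hadd : ∀ v w, c (v + w) = c v + c w := fun v w ↦ by
    ext s
    induction s using Sym2.ind with
    | h i k =>
      rw [Pi.add_apply, hc_apply, hc_apply, hc_apply, map_add, Submodule.coe_add,
        Matrix.map_add _ (map_add _), Matrix.mul_add, Matrix.add_mul, Matrix.add_apply]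
  have hsmul : ∀ (t : ℂ) v, c (t • v) = conj t • c v := fun t v ↦ by
    ext s
    induction s using Sym2.ind with
    | h i k =>
      have hm : ((t • (coordCLE g).symm v : symmetricSubmodule (Fin g) ℂ) : Matrix (Fin g) (Fin g) ℂ).map conj =
          conj t • ((coordCLE g).symm v : Matrix (Fin g) (Fin g) ℂ).map conj := by
        rw [Submodule.coe_smul]
        ext a b
        simp [Matrix.map_apply]
      rw [Pi.smul_apply, hc_apply, hc_apply, map_smul, hm, Matrix.mul_smul, Matrix.smul_mul, Matrix.smul_apply]
  have hcc : ∀ v, c (c v) = v := fun v ↦ by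
    ext s
    induction s using Sym2.ind with
    | h i k =>
      rw [hc_apply, hc_symm, locusConj_locusConj hjj, coe_coordCLE_symm_apply]
  have hfix : ∀ v, c v = v ↔ J * ((coordCLE g).symm v : Matrix (Fin g) (Fin g) ℂ) =
      -((coordCLE g).symm v : Matrix (Fin g) (Fin g) ℂ).map conj * J := fun v ↦ by
    rw [← locusConj_eq_self_iff hjj]
    constructor
    · intro h
      rw [← hc_symm, h]
    · intro h
      have e : c v = coordCLE g ((coordCLE g).symm v) := by
        rw [hc]
        dsimp only
        congr 1
        exact Subtype.ext h
      rw [e, ContinuousLinearEquiv.apply_symm_apply]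
  -- `c_j` as an `ℝ`-linear map
  set cℝ : (Sym2 (Fin g) → ℂ) →ₗ[ℝ] (Sym2 (Fin g) → ℂ) :=
    { toFun := c
      map_add' := hadd
      map_smul' := fun r v ↦ by
        rw [RingHom.id_apply, ← Complex.coe_smul, ← Complex.coe_smul, hsmul, Complex.conj_ofReal] } with hcℝ
  have hcℝ_apply : ∀ v, cℝ v = c v := fun v ↦ rfl
  refine ⟨LinearMap.ker (cℝ - LinearMap.id), fun v ↦ ?_, ?_⟩
  · rw [LinearMap.mem_ker, LinearMap.sub_apply, LinearMap.id_apply, sub_eq_zero, hcℝ_apply, hfix]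
  · rw [finrank_ker_sub_id_of_conjLinear_involution cℝ (fun v ↦ ?_) (fun v ↦ ?_), finrank_fintype_fun_eq_card]
    · rw [hcℝ_apply, hcℝ_apply, hsmul, Complex.conj_I, neg_smul]
    · rw [hcℝ_apply, hcℝ_apply, hcc]

end Locus

end SiegelModuli

end Literature.AlgebraicGeometry.ModuliOfAbelianVarieties
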